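import Summits.QuantumFields.YangMills.Theorems.UnitScaleTiltHalvingHSiteT4OfLeafSockets
import Literature.MathematicalPhysics.QuantumFieldTheory.Balaban1983to89.B8SockHFPWindows
import HarnessLib

/-!
# `hP1room` PROGRAMME (LEAD-H BOARD v5 → v6, WORD 9 «(K-sock) GO», WORD 10 `SB9AllL` SHAPE RULING), ROW (K-sock) FILE C:
# ★★★ THE GUARDED THEOREM-4 SOCKET `hT4T` FROM THE LEAF SOCKETS ONLY — the raw (1.59) socket served from the b9 edge (§1), v6b (§2), and the JOIN's windows below ONE threshold (§3)

Route `UnitScaleTilt`, crux K1 child «MinimiserStabilityRegPr» (stmt-QuantumFields-19200), registered stub `stub_halvingStep` (`BirthV10`).  Cell `ym3-torus` (HUMAN RULING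
D-0037: YM₃ on T³ is ladder rung R3 — NOT d = 4, NOT a mass gap, NOT the Clay problem), width seat `ym-ust-19200-w3` gen 9.  `--supports stmt-QuantumFields-19200 --as helper`;
THEOREMS ONLY (0 `def`, 0 `sorry`); count-neutral; nothing here claims `hMember`, `hSupUρ4`, the stub, the crux or the gap.

* §1 ★ `H59raw_of_SB9all` — ✓p667955 §2's raw (1.59) socket `H59` ([4] Thm 3.3 in Theorem 4's frame, `U₀ = 1`, levels `1 ≤ m ≤ K − n`, ∀ `gJ`-closed under J3's three rows) from the b9
  edge `SB9all` (lit `SockB9P3`, `∃ len` per level — LEAD-H WORD 10) under two scalar windows `ε₀ ≤ cB9`, `2(L·c⋆) + 8α₄ ≤ cB9`; the junction of lit ✓`B8LeafSocketsB9.sockH59_of_allLevels`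
  per level (`W` unitary ✓`mem_unitaryUnits_of_mgauge_eq`; `W·1 ∈ 𝔄_m` by ✓`mulCfg_eq_gaugeAct_of_mgauge_eq` + ✓`inAk_gaugeAct_iff` from J3's (1.34)-𝔄; (1.29) idle — print drops it
  via Prop. 6, p.83, ★w7-19200 g6 `LOCATE-H59TL-TOP`).
* §2 ★★★ `hT4T_of_leafSocketsB9` — FILE B ✓`hT4T_of_leafSockets` ∘ §1: `hT4T` ⟸ `SLetτAll ∧ SB9all` (+ scalar windows) ONLY.
* §3 `exists_threshold_hwin` — lit ✓`B8SockHFPWindows.hfpWindows_of_guard` at `d := 3`: the `hwin` conjunction below ONE member-uniform threshold `cP(L, consts)` on `ε₀ + α₁`.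
HONEST SCOPE.  By-name plumbing; the letters, the b9 edge and the windows are DISPLAYED hypotheses (N05∕N06 deliverables); nothing of [4], Prop. 3∕5∕6, Theorem 4, `hMember`, the stub or
the crux is proved here.  Rung R3 (YM₃ on T³), NOT Clay; YM gap NOT proved.

References: T. Bałaban, CMP **99** (1985) 75–102 [Balaban1985RegularSpaces] (Thm 4 p.88, Prop. 5 (1.106)–(1.109) p.94, (1.57)–(1.59) p.86, (1.40)–(1.42) p.83, (1.102)–(1.103) p.93,
p.89, p.76, p.98); CMP **99** (1985) 389–434 [Balaban1985BackgroundPropagators] (Thm 3.1 p.397, (3.25) p.394, Thm 3.3 p.398).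
-/

set_option autoImplicit false

noncomputable section

open scoped BigOperators Matrix.Norms.L2Operator
open NormedSpace
open Complex (I)

namespace Summit.QuantumFields.YangMills.Theorems.HalvingHSiteT4OfLeafSocketsB9

open Literature.MathematicalPhysics.QuantumFieldTheory.Balaban1983to89
open Literature.MathematicalPhysics.QuantumFieldTheory.Balaban1983to89.T3ContinuumYM3Torus
open MatrixLog (mlog)
open B5Eq118OneStroke (iterBlockOf)
open B7Prop1Explicit (e expUnit)
open B7Prop1Explicit renaming Site → LSite
open B7Prop2Explicit (unitaryUnits C0 c2' avgIter)
open B7Prop2SpecialUnitary (specialUnitaryUnits mem_specialUnitaryUnits specialUnitaryUnits_le_unitaryUnits)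
open B7Prop3Flat (c3)
open B7Prop10General (C6 C4G)
open B7Prop9Flat (C5')
open B7Prop1Local (InBox)
open B7Eq78Linearization (conjR zdBlocking QprimeIter)
open B7Eq92Concrete (mgauge)
open B8Ineq130 (tlo thi)
open B8Ineq132 (covDerivFwd InAk)
open B8Eq119TwistedAxial (Restr129 InAx bgT)
open B8Eq131Cubes (tLo tHi)
open B8Eq131CubesAdmissible (cubeFam)
open B8CubeMemberZd (cubeLamS cubeLamB)
open B8Eq184Proof (gaugeExp cfgExp)
open B8Eq140Level (SideTouches)
open B8Eq146AExpansion (iEta)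
open B8Eq138LandauZd (IsLandau138W covLap QT)
open B7Prop4GeneralLevels (logCovIter linCovIter)
open B8Eq155JBound (Jcur wsup)
open B8ScaledSupNorm (bondNorm msup)
open B8Ineq125Concrete (C2p)
open B8Eq1117Concrete (XSpace)
open B8LeafModelZd3 (SockB9P3)
open B8Prop5ContractionKLevel (Bd2 Mc Kc)
open B8LambdaSpaceKLevel (wt)
open B8SpecialUnitaryTrace (trCLM trCLM_mul_comm gaugeExp_mem_specialUnitaryUnits)
open B8SpecialLinearTrace (specialUnitaryUnits_le_slUnits trCLM_mlog_eq_zero_of_mem_slUnits expUnit_mem_slUnits avgClosed_specialUnitary)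
open B13Inv214OrbitSUN (slUnits)
open B10Eq27TorusAxialLog (pull pull_apply unitsField toUField unitsField_mem_unitaryUnits)
open HalvingP1FlatCoreSupplierDatumTrace (pull_unitsField_toUField_mem_SU)
open HalvingHSiteT4OfLeafSockets (hT4T_of_leafSockets)
open B8Lemma1NonAbelian (mulCfg)
open B7Prop1Explicit (U1)
open B7Prop2Explicit (unitaryUnits_le_U1)
open B8Prop6OfThm4 (one_inAk)
open B8Prop3GaugeFixedKLevel (mem_unitaryUnits_of_mgauge_eq mulCfg_eq_gaugeAct_of_mgauge_eq)
open B8SockHFPWindows (hfpWindows_of_guard)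
open HalvingP1FlatCoreSupplierInduction (h34_of_inAk_univ)

variable (F : T3Family) {n K : ℕ}

/-! ## §1 The raw (1.59) socket `H59` of ✓p667955 §2 from the b9 edge at every level -/

set_option maxHeartbeats 400000 in
/-- ★ **THE RAW (1.59) SOCKET OF ✓p667955 §2 (`H59`, [4] Thm 3.3 in Theorem 4's frame at `U₀ = 1`, levels `1 ≤ m ≤ K − n`, ∀ `gJ`-closed under J3's three rows) FROM THE b9 EDGE `SB9all`** —
the junction of lit ✓`B8LeafSocketsB9.sockH59_of_allLevels` run per level against lit `SockB9P3@m` (its `len` now `∃`-bound per `m`, LEAD-H WORD 10): the datum `(u, W, A′)` at level `m` is a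
datum of `SockB9P3` at `(α₀, α₂) := (ε₀, 2(L·c⋆) + 8α₄)` — `W` unitary by lit ✓`mem_unitaryUnits_of_mgauge_eq`, `W·1 = (U′·1)^{u⁻¹} ∈ 𝔄_m` by lit ✓`mulCfg_eq_gaugeAct_of_mgauge_eq` + ✓`inAk_gaugeAct_iff`
from J3's (1.34)-𝔄 (✓`h34_of_inAk_univ`, levels restricted), `1 ∈ 𝔄` by lit ✓`one_inAk`; the (1.29) guard and the axial ∕ tower rows are idle (print drops (1.29) via Prop. 6, p.83;
★w7-19200 g6 `LOCATE-H59TL-TOP` 039d0f5e) — and (1.59)'s first two lines are the conclusion. [cite: Balaban1985RegularSpaces, (1.57)–(1.59) p.86, (1.40)–(1.42) p.83, Thm 4 p.88; Balaban1985BackgroundPropagators, Thm 3.3 p.398] -/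
theorem H59raw_of_SB9all (L : ℕ) (ρ S M M' : ℕ) {ρ' : ℕ} (hρ'def : ρ' = ρ + M + L + S)
    {ε₀ : ℝ} (hε₀ : 0 < ε₀) {s : ℝ} (U : GaugeField (F.P K) 0 (Matrix.specialUnitaryGroup (Fin 2) ℂ)) (x₀ : Site (F.P K) 0)
    {t : ℤ} {a : LSite (F.P K).d} (hadef : a = fun μ => ((iterBlockOf (K - n) x₀ μ).val : ℤ) - t)
    -- Theorem 4's size letters `c⋆`, `α₄ := 8B₀′c⋆` and the b9 threshold with its TWO windows `ε₀ ≤ cB9`, `2(L·c⋆) + 8α₄ ≤ cB9` (LEAD-H WORD 10: «from `hw`'s `(1 + cB9⁻¹)`»)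
    {α₁ α₄ B₀ B₀' cstar : ℝ} (hα₁ : 0 < α₁) (hB₀ : 0 < B₀) (hB₀' : 0 < B₀')
    (hc : cstar = 5 * (F.P K).d * (F.P K).L * B₀ * (ε₀ + α₁)) (hα₄ : α₄ = 8 * B₀' * (5 * ((F.P K).d : ℝ) * (F.P K).L * B₀) * (ε₀ + α₁))
    {B₀β cB9 β : ℝ}
    (SB9all : ∀ m, m ≤ K - n → ∃ len : LSite (F.P K).d → ℝ,
      @SockB9P3 (F.P K).d (Matrix (Fin 2) (Fin 2) ℂ) (B10Eq29TubeLine.cstarAlgebraMatrix 2) (F.P K).L B₀ B₀β cB9 β len (((F.L : ℝ)⁻¹) ^ (K - n)) m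
        (cubeFam false (F.P K).L a M' ρ' (K - n)) (cubeLamS (F.P K).L a M' ρ' (K - n)) (cubeLamB (F.P K).L a M' ρ' (K - n)))
    (hε9 : ε₀ ≤ cB9) (h9 : 2 * ((F.P K).L * cstar) + 8 * α₄ ≤ cB9) :
    ∀ gJ : GaugeTransf (F.P K) 0 (Matrix.specialUnitaryGroup (Fin 2) ℂ),
      InAk (F.P K).L (K - n) (((F.L : ℝ)⁻¹) ^ (K - n)) ε₀ (fun _ => (Set.univ : Set (LSite (F.P K).d))) (pull (unitsField (toUField (GaugeField.gaugeAct gJ U))) 0) →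
      (∀ m', m' ≤ K - n → ∀ Λ : ℕ → Set (LSite (F.P K).d),
        InAx (F.P K).L m' Λ (1 : LSite (F.P K).d → Fin (F.P K).d → (Matrix (Fin 2) (Fin 2) ℂ)ˣ) (pull (unitsField (toUField (GaugeField.gaugeAct gJ U))) 0)) →
      (∀ m', m' ≤ K - n → ∀ (x : LSite (F.P K).d) (ν : Fin (F.P K).d), tlo (F.P K).L (tLo a ρ') m' ≤ x → x + e ν ≤ thi (F.P K).L (tHi a M' ρ') m' →
        ‖((avgIter (F.P K).L (pull (unitsField (toUField (GaugeField.gaugeAct gJ U))) 0) (K - n - m') x ν : (Matrix (Fin 2) (Fin 2) ℂ)ˣ) :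
            Matrix (Fin 2) (Fin 2) ℂ) - 1‖ < s) →
      ∀ m, 1 ≤ m → m ≤ K - n → ∀ (u : LSite (F.P K).d → (Matrix (Fin 2) (Fin 2) ℂ)ˣ) (W : LSite (F.P K).d → Fin (F.P K).d → (Matrix (Fin 2) (Fin 2) ℂ)ˣ) (A' : LSite (F.P K).d → Fin (F.P K).d → (Matrix (Fin 2) (Fin 2) ℂ)),
      (∀ x, u x ∈ unitaryUnits (Matrix (Fin 2) (Fin 2) ℂ)) → mgauge (1 : LSite (F.P K).d → Fin (F.P K).d → (Matrix (Fin 2) (Fin 2) ℂ)ˣ) u W = (pull (unitsField (toUField (GaugeField.gaugeAct gJ U))) 0) → Restr129 (F.P K).L m ((cubeLamS (F.P K).L a M' ρ' (K - n)) m) (1 : LSite (F.P K).d → Fin (F.P K).d → (Matrix (Fin 2) (Fin 2) ℂ)ˣ) u → IsLandau138W (F.P K).L m (((F.L : ℝ)⁻¹) ^ (K - n)) ((cubeFam false (F.P K).L a M' ρ' (K - n)) 0) ((cubeLamS (F.P K).L a M' ρ' (K - n)) m) (1 : LSite (F.P K).d → Fin (F.P K).d → (Matrix (Fin 2) (Fin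 2) ℂ)ˣ) W →
      (∀ y τ, IsSelfAdjoint (A' y τ)) →
      (∀ j, j ≤ m → ∀ y τ, SideTouches ((cubeFam false (F.P K).L a M' ρ' (K - n)) j) y τ →
        W y τ = cfgExp (((F.L : ℝ)⁻¹) ^ (K - n)) A' y τ ∧ ‖A' y τ‖ ≤ (2 * ((F.P K).L * cstar) + 8 * α₄) * (((F.P K).L : ℝ) ^ j * (((F.L : ℝ)⁻¹) ^ (K - n)))⁻¹) →
      (∀ y τ, (∀ j, j ≤ m → ¬ SideTouches ((cubeFam false (F.P K).L a M' ρ' (K - n)) j) y τ) → A' y τ = 0) →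
      msup (F.P K).L m (((F.L : ℝ)⁻¹) ^ (K - n)) (-(1 : ℝ)) (fun j (b : LSite (F.P K).d × Fin (F.P K).d) => SideTouches ((cubeFam false (F.P K).L a M' ρ' (K - n)) j) b.1 b.2) (fun b => A' b.1 b.2)
          ≤ B₀ * (bondNorm (F.P K).L m (((F.L : ℝ)⁻¹) ^ (K - n)) (-(3 : ℝ)) (cubeFam false (F.P K).L a M' ρ' (K - n)) (fun x μ => Jcur (((F.L : ℝ)⁻¹) ^ (K - n)) (1 : LSite (F.P K).d → Fin (F.P K).d → (Matrix (Fin 2) (Fin 2) ℂ)ˣ) A' μ x)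
            + wsup 1 (fun p : {p : ℕ × (LSite (F.P K).d × Fin (F.P K).d) // p.1 ≤ m ∧ p.2 ∈ (cubeLamB (F.P K).L a M' ρ' (K - n)) m p.1} =>
                linCovIter (F.P K).L (1 : LSite (F.P K).d → Fin (F.P K).d → (Matrix (Fin 2) (Fin 2) ℂ)ˣ) (iEta (((F.L : ℝ)⁻¹) ^ (K - n)) A') p.1.1 p.1.2.1 p.1.2.2)) ∧
        msup (F.P K).L m (((F.L : ℝ)⁻¹) ^ (K - n)) (-(2 : ℝ)) (fun j (t : Fin (F.P K).d × Fin (F.P K).d × LSite (F.P K).d) => SideTouches ((cubeFam false (F.P K).L a M' ρ' (K - n)) j) t.2.2 t.2.1)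
            (fun t => covDerivFwd (((F.L : ℝ)⁻¹) ^ (K - n)) (1 : LSite (F.P K).d → Fin (F.P K).d → (Matrix (Fin 2) (Fin 2) ℂ)ˣ) t.1 (fun z => A' z t.2.1) t.2.2)
          ≤ B₀ * (bondNorm (F.P K).L m (((F.L : ℝ)⁻¹) ^ (K - n)) (-(3 : ℝ)) (cubeFam false (F.P K).L a M' ρ' (K - n)) (fun x μ => Jcur (((F.L : ℝ)⁻¹) ^ (K - n)) (1 : LSite (F.P K).d → Fin (F.P K).d → (Matrix (Fin 2) (Fin 2) ℂ)ˣ) A' μ x)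
            + wsup 1 (fun p : {p : ℕ × (LSite (F.P K).d × Fin (F.P K).d) // p.1 ≤ m ∧ p.2 ∈ (cubeLamB (F.P K).L a M' ρ' (K - n)) m p.1} =>
                linCovIter (F.P K).L (1 : LSite (F.P K).d → Fin (F.P K).d → (Matrix (Fin 2) (Fin 2) ℂ)ˣ) (iEta (((F.L : ℝ)⁻¹) ^ (K - n)) A') p.1.1 p.1.2.1 p.1.2.2)) := by
  letI : CStarAlgebra (Matrix (Fin 2) (Fin 2) ℂ) := B10Eq29TubeLine.cstarAlgebraMatrix 2
  subst hadef hρ'def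
  intro gJ hInAk _ _ m _ hmk u W A' hu hW _ hLan hsa hWA hA0
  have hL1 : 1 ≤ (F.P K).L := le_trans (by norm_num) (F.P K).hL.2
  have hη : 0 < ((F.L : ℝ)⁻¹) ^ (K - n) := by
    have hL0 : (0 : ℝ) < F.L := by exact_mod_cast (F.P K).L_pos
    positivity
  have hK0 : 0 < 2 * ((F.P K).L * cstar) + 8 * α₄ := by
    have hL0 : (0 : ℝ) < (F.P K).L := by exact_mod_cast (F.P K).L_pos
    have hd0 : (0 : ℝ) < (F.P K).d := by rw [T3Family.P_d F K]; norm_num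
    have hs : 0 < ε₀ + α₁ := add_pos hε₀ hα₁
    have hcs : 0 < cstar := by rw [hc]; positivity
    have hα₄0 : 0 ≤ α₄ := by rw [hα₄]; positivity
    positivity
  -- the b9 edge at level `m`
  obtain ⟨len, SB9⟩ := SB9all m hmk
  -- the datum is a datum of `SockB9P3` at level `m`, background `1`
  have h1u : ∀ (x : LSite (F.P K).d) (κ : Fin (F.P K).d), (1 : LSite (F.P K).d → Fin (F.P K).d → (Matrix (Fin 2) (Fin 2) ℂ)ˣ) x κ ∈ unitaryUnits (Matrix (Fin 2) (Fin 2) ℂ) :=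
    fun _ _ => (unitaryUnits (Matrix (Fin 2) (Fin 2) ℂ)).one_mem
  have hU' : ∀ (x : LSite (F.P K).d) (κ : Fin (F.P K).d),
      pull (unitsField (toUField (GaugeField.gaugeAct gJ U))) 0 x κ ∈ unitaryUnits (Matrix (Fin 2) (Fin 2) ℂ) :=
    fun x κ => by rw [pull_apply]; exact unitsField_mem_unitaryUnits _ _
  have hWu : ∀ x κ, W x κ ∈ unitaryUnits (Matrix (Fin 2) (Fin 2) ℂ) := mem_unitaryUnits_of_mgauge_eq h1u hU' hu hW
  have h33m : InAk (F.P K).L m (((F.L : ℝ)⁻¹) ^ (K - n)) ε₀ (cubeFam false (F.P K).L (fun μ => ((iterBlockOf (K - n) x₀ μ).val : ℤ) - t) M' (ρ + M + L + S) (K - n))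
      (1 : LSite (F.P K).d → Fin (F.P K).d → (Matrix (Fin 2) (Fin 2) ℂ)ˣ) := one_inAk hL1 m hη hε₀ _
  have h34m : InAk (F.P K).L m (((F.L : ℝ)⁻¹) ^ (K - n)) ε₀ (cubeFam false (F.P K).L (fun μ => ((iterBlockOf (K - n) x₀ μ).val : ℤ) - t) M' (ρ + M + L + S) (K - n))
      (mulCfg W (1 : LSite (F.P K).d → Fin (F.P K).d → (Matrix (Fin 2) (Fin 2) ℂ)ˣ)) := by
    have h34 := h34_of_inAk_univ hInAk (cubeFam false (F.P K).L (fun μ => ((iterBlockOf (K - n) x₀ μ).val : ℤ) - t) M' (ρ + M + L + S) (K - n))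
    have h1 : InAk (F.P K).L m (((F.L : ℝ)⁻¹) ^ (K - n)) ε₀ (cubeFam false (F.P K).L (fun μ => ((iterBlockOf (K - n) x₀ μ).val : ℤ) - t) M' (ρ + M + L + S) (K - n))
        (mulCfg (pull (unitsField (toUField (GaugeField.gaugeAct gJ U))) 0) (1 : LSite (F.P K).d → Fin (F.P K).d → (Matrix (Fin 2) (Fin 2) ℂ)ˣ)) :=
      fun j hj => h34 j (hj.trans hmk)
    have hui : ∀ x, u⁻¹ x ∈ U1 (Matrix (Fin 2) (Fin 2) ℂ) := fun x => unitaryUnits_le_U1 ((unitaryUnits (Matrix (Fin 2) (Fin 2) ℂ)).inv_mem (hu x))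
    rw [mulCfg_eq_gaugeAct_of_mgauge_eq hW]
    exact (B8Ineq132.inAk_gaugeAct_iff (F.P K).L m _ ε₀ _ hui _).2 h1
  subst hc hα₄
  obtain ⟨ha, hg, -, -, -⟩ := SB9 ε₀ _ hε₀ hε9 hK0 h9 (1 : LSite (F.P K).d → Fin (F.P K).d → (Matrix (Fin 2) (Fin 2) ℂ)ˣ) W h1u hWu h33m h34m hLan A' hsa hWA hA0
  exact ⟨ha, hg⟩

/-! ## §2 The guarded Theorem-4 socket `hT4T` from the LEAF SOCKETS ONLY: letters-τ at every truncation + the b9 edge at every level (v6b) -/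

set_option maxHeartbeats 400000 in
/-- ★★★ **THE GUARDED THEOREM-4 SOCKET `hT4T` OF ✓p667955 FROM THE [4] LETTERS (+ `τ`-laws) AT EVERY TRUNCATION AND THE b9 EDGE AT EVERY LEVEL — NOTHING ELSE** (v6b): FILE B's
✓`hT4T_of_leafSockets` with its raw (1.59) socket `H59` SERVED by §1 `H59raw_of_SB9all` (two more scalar windows `ε₀ ≤ cB9`, `2(L·c⋆) + 8α₄ ≤ cB9`).  With the v6 wrappers (★w3-20520 g7 step,
★w7-19200 g6 base) H's display reads «per `L` ∃ consts signs, `SLetτAllL ∧ SB9AllL`» — [4] Thm 3.1∕(3.25) letters at every truncation + the b9 edge at every level; nothing of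
[Balaban1985RegularSpaces] displayed. [cite: Balaban1985RegularSpaces, Thm 4 p.88, Prop. 5 (1.106)–(1.109) p.94, (1.59) p.86, p.76, p.98; Balaban1985BackgroundPropagators, Thm 3.1 p.397, (3.25) p.394, Thm 3.3 p.398] -/
theorem hT4T_of_leafSocketsB9 (L : ℕ) (hF : F.L = L) (hnK : n < K) (ρ S M M' : ℕ) {ρ' : ℕ} (hρ'def : ρ' = ρ + M + L + S)
    {ε₀ : ℝ} (hε₀ : 0 < ε₀) {s : ℝ} (U : GaugeField (F.P K) 0 (Matrix.specialUnitaryGroup (Fin 2) ℂ)) (x₀ : Site (F.P K) 0)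
    {t : ℤ} {a : LSite (F.P K).d} (hadef : a = fun μ => ((iterBlockOf (K - n) x₀ μ).val : ℤ) - t)
    -- Theorem 4's constants and windows ((τ-D)'s binders VERBATIM at `d := (F.P K).d`, `L := (F.P K).L`, `α₀ := ε₀`, `a := s`)
    {α₁ α₄ B₀ B₀' cstar C₂ : ℝ} (hα₁ : 0 < α₁) (hB₀ : 0 < B₀) (hB₀' : 0 < B₀') (hsα₁ : s ≤ α₁) (hsmall₁ : ((F.P K).d : ℝ) * (F.P K).L * α₁ ≤ 1 / 8)
    (hc : cstar = 5 * (F.P K).d * (F.P K).L * B₀ * (ε₀ + α₁)) (hα₄ : α₄ = 8 * B₀' * (5 * ((F.P K).d : ℝ) * (F.P K).L * B₀) * (ε₀ + α₁))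
    (hs₁ : α₄ ≤ 1 / 84) (hs₂ : (F.P K).L * cstar ≤ 1 / 12) (hsa4 : s ≤ 1 / 4) (hs2c : 2 * s ≤ cstar)
    (hα3 : C0 (F.P K).d * ε₀ ≤ 1 / 3) (hα4 : 4 * ε₀ ≤ c2' (F.P K).d (F.P K).L)
    (h16 : 16 * (2 * ((F.P K).L * cstar) + 8 * α₄) ≤ 1) (hd5 : 5 * (2 * ((F.P K).L * cstar) + 8 * α₄) * (((F.P K).d : ℝ) - 1) ≤ 4)
    (hsmall : Real.exp (4 * (800 * (((F.P K).d : ℝ) + 1) ^ 2 * (((F.P K).d : ℝ) + 4)) * ε₀)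
      * (1 + 8 * (131072 * (((F.P K).d : ℝ) + 1) ^ 2) * (2 * ((F.P K).L * cstar) + 8 * α₄)) ≤ 2)
    (hc₃ : 2 * (2 * ((F.P K).L * cstar) + 8 * α₄) ≤ c3 (F.P K).d (F.P K).L) (hside : 36 * (F.P K).d * B₀ * (2 * ((F.P K).L * cstar) + 8 * α₄) ≤ 1 / 2)
    (h50 : 50 * (F.P K).d * (2 * ((F.P K).L * cstar) + 8 * α₄) ≤ 1)
    (hC₂ : 8 * (131072 * (((F.P K).d : ℝ) + 1) ^ 2) * Real.exp (4 * (800 * (((F.P K).d : ℝ) + 1) ^ 2 * (((F.P K).d : ℝ) + 4)) * ε₀) ≤ C₂)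
    (h61 : 2 * (2 * ((F.P K).L * cstar) + 8 * α₄) ^ 2 + 20 * (F.P K).d * ε₀ * (2 * ((F.P K).L * cstar) + 8 * α₄)
      + 2 * C₂ * (2 * ((F.P K).L * cstar) + 8 * α₄) ^ 2 ≤ ε₀ + α₁)
    -- THE LEAF SOCKETS replacing the raw `hP5base` ∕ `hP5` (Prop. 5): the [4] LETTERS (+ their `τ`-laws at `τ := tr`) AT EVERY TRUNCATION `n′ ≤ K − n` at the flat background on
    -- the member's cube families — lit `SockLettersRD`'s body at `(ε₀, U₀ := 1, n′)` ∧ lit `LettersTau`'s three fields (✓p654110's `SLetτ` shape, there at the top truncation only;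
    -- [4] Thm 3.1 ∕ (3.25), N05∕N06) — and the b9 EDGE lit `SockB9P3` AT EVERY LEVEL `m ≤ K − n` ([4] Thm 3.3 in Prop. 3's frame, N06); both `gJ`-independent (geometry only)
    {B₀'H B₂' BG BR : ℝ} (hB₀'H : 0 < B₀'H) (hB₂' : 0 ≤ B₂') (hBG : 0 ≤ BG) (hBR : 0 ≤ BR)
    (SLetτAll : ∀ n', 1 ≤ n' → n' ≤ K - n →
      ∃ (g Δ : (LSite (F.P K).d → Matrix (Fin 2) (Fin 2) ℂ) →ₗ[ℂ] (LSite (F.P K).d → Matrix (Fin 2) (Fin 2) ℂ))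
        (q : (LSite (F.P K).d → Matrix (Fin 2) (Fin 2) ℂ) →ₗ[ℂ] (ℕ → LSite (F.P K).d → Matrix (Fin 2) (Fin 2) ℂ))
        (qs : (ℕ → LSite (F.P K).d → Matrix (Fin 2) (Fin 2) ℂ) →ₗ[ℂ] (LSite (F.P K).d → Matrix (Fin 2) (Fin 2) ℂ))
        (Aw c : (ℕ → LSite (F.P K).d → Matrix (Fin 2) (Fin 2) ℂ) →ₗ[ℂ] (ℕ → LSite (F.P K).d → Matrix (Fin 2) (Fin 2) ℂ))
        (H' : XSpace (F.P K).d n' (Matrix (Fin 2) (Fin 2) ℂ) →ₗ[ℂ] (LSite (F.P K).d → Matrix (Fin 2) (Fin 2) ℂ)),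
      (∀ x, ∀ y ∈ cubeFam false (F.P K).L a M' ρ' (K - n) 0, (Δ (g x) + qs (Aw (q (g x)))) y = x y) ∧ (∀ f, q (g (g (qs (c (q f))))) = q f) ∧
      (∀ (f : LSite (F.P K).d → Matrix (Fin 2) (Fin 2) ℂ), ∀ x ∈ cubeFam false (F.P K).L a M' ρ' (K - n) 0,
        Δ f x = covLap (((F.L : ℝ)⁻¹) ^ (K - n)) (1 : LSite (F.P K).d → Fin (F.P K).d → (Matrix (Fin 2) (Fin 2) ℂ)ˣ) ((cubeFam false (F.P K).L a M' ρ' (K - n) 0).indicator f) x) ∧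
      (∀ (μ : ℕ → LSite (F.P K).d → Matrix (Fin 2) (Fin 2) ℂ), ∀ x ∈ cubeFam false (F.P K).L a M' ρ' (K - n) 0,
        qs μ x = QT (F.P K).L n' (cubeLamS (F.P K).L a M' ρ' (K - n) n') (1 : LSite (F.P K).d → Fin (F.P K).d → (Matrix (Fin 2) (Fin 2) ℂ)ˣ) μ x) ∧
      (∀ (f : LSite (F.P K).d → Matrix (Fin 2) (Fin 2) ℂ) (j : ℕ), j ≤ n' → ∀ y ∈ cubeLamS (F.P K).L a M' ρ' (K - n) n' j,
        q f j y = QprimeIter (zdBlocking (F.P K).d (F.P K).L) (bgT (F.P K).L (1 : LSite (F.P K).d → Fin (F.P K).d → (Matrix (Fin 2) (Fin 2) ℂ)ˣ)) j f y) ∧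
      (∀ (X : XSpace (F.P K).d n' (Matrix (Fin 2) (Fin 2) ℂ)) (x : LSite (F.P K).d), ‖H' X x‖ ≤ B₀'H * ‖X‖) ∧
      (∀ j, j ≤ n' → ∀ (X : XSpace (F.P K).d n' (Matrix (Fin 2) (Fin 2) ℂ)), ∀ p ∈ {b : LSite (F.P K).d × Fin (F.P K).d | SideTouches (cubeFam false (F.P K).L a M' ρ' (K - n) j) b.1 b.2},
        wt (F.P K).L (((F.L : ℝ)⁻¹) ^ (K - n)) j * ‖covDerivFwd (((F.L : ℝ)⁻¹) ^ (K - n)) (1 : LSite (F.P K).d → Fin (F.P K).d → (Matrix (Fin 2) (Fin 2) ℂ)ˣ) p.2 (H' X) p.1‖ ≤ B₀'H * ‖X‖) ∧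
      (∀ X : XSpace (F.P K).d n' (Matrix (Fin 2) (Fin 2) ℂ), Bd2 (F.P K).L (((F.L : ℝ)⁻¹) ^ (K - n)) n' (cubeFam false (F.P K).L a M' ρ' (K - n))
        (covLap (((F.L : ℝ)⁻¹) ^ (K - n)) (1 : LSite (F.P K).d → Fin (F.P K).d → (Matrix (Fin 2) (Fin 2) ℂ)ˣ) (H' X)) (B₂' * ‖X‖)) ∧
      (∀ (X : XSpace (F.P K).d n' (Matrix (Fin 2) (Fin 2) ℂ)) (x : LSite (F.P K).d), x ∉ cubeFam false (F.P K).L a M' ρ' (K - n) 0 → H' X x = 0) ∧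
      (∀ X Y : XSpace (F.P K).d n' (Matrix (Fin 2) (Fin 2) ℂ), (∀ p, Y p = -star (X p)) → ∀ x, H' Y x = -star (H' X x)) ∧
      (∀ (Y : XSpace (F.P K).d n' (Matrix (Fin 2) (Fin 2) ℂ)) (j : ℕ) (hj : j ≤ n') (y : LSite (F.P K).d), y ∈ cubeLamS (F.P K).L a M' ρ' (K - n) n' j →
        QprimeIter (zdBlocking (F.P K).d (F.P K).L) (bgT (F.P K).L (1 : LSite (F.P K).d → Fin (F.P K).d → (Matrix (Fin 2) (Fin 2) ℂ)ˣ)) j (H' Y) y = Y (⟨j, Nat.lt_succ_of_le hj⟩, y)) ∧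
      (∀ (f : LSite (F.P K).d → Matrix (Fin 2) (Fin 2) ℂ) (r : ℝ), 0 ≤ r → Bd2 (F.P K).L (((F.L : ℝ)⁻¹) ^ (K - n)) n' (cubeFam false (F.P K).L a M' ρ' (K - n)) f r →
        (∀ x, ‖g f x‖ ≤ BG * r) ∧ ∀ j, j ≤ n' → ∀ p ∈ {b : LSite (F.P K).d × Fin (F.P K).d | SideTouches (cubeFam false (F.P K).L a M' ρ' (K - n) j) b.1 b.2},
          wt (F.P K).L (((F.L : ℝ)⁻¹) ^ (K - n)) j * ‖covDerivFwd (((F.L : ℝ)⁻¹) ^ (K - n)) (1 : LSite (F.P K).d → Fin (F.P K).d → (Matrix (Fin 2) (Fin 2) ℂ)ˣ) p.2 (g f) p.1‖ ≤ BG * r) ∧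
      (∀ (f : LSite (F.P K).d → Matrix (Fin 2) (Fin 2) ℂ) (x : LSite (F.P K).d), x ∉ cubeFam false (F.P K).L a M' ρ' (K - n) 0 → g f x = 0) ∧
      (∀ f : LSite (F.P K).d → Matrix (Fin 2) (Fin 2) ℂ, (∀ j, j ≤ n' → ∀ x ∈ cubeFam false (F.P K).L a M' ρ' (K - n) j, IsSelfAdjoint (f x)) → ∀ x, IsSelfAdjoint (g f x)) ∧
      (∀ (f : LSite (F.P K).d → Matrix (Fin 2) (Fin 2) ℂ) (r : ℝ), 0 ≤ r → Bd2 (F.P K).L (((F.L : ℝ)⁻¹) ^ (K - n)) n' (cubeFam false (F.P K).L a M' ρ' (K - n)) f r →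
        Bd2 (F.P K).L (((F.L : ℝ)⁻¹) ^ (K - n)) n' (cubeFam false (F.P K).L a M' ρ' (K - n)) (f - g (qs (c (q (g f))))) (BR * r)) ∧
      (∀ f : LSite (F.P K).d → Matrix (Fin 2) (Fin 2) ℂ, (∀ j, j ≤ n' → ∀ x ∈ cubeFam false (F.P K).L a M' ρ' (K - n) j, IsSelfAdjoint (f x)) →
        ∀ j, j ≤ n' → ∀ x ∈ cubeFam false (F.P K).L a M' ρ' (K - n) j, IsSelfAdjoint ((f - g (qs (c (q (g f))))) x)) ∧
      (∀ X : XSpace (F.P K).d n' (Matrix (Fin 2) (Fin 2) ℂ), (∀ p, trCLM (Fin 2) (X p) = 0) → ∀ x, trCLM (Fin 2) (H' X x) = 0) ∧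
      (∀ f : LSite (F.P K).d → Matrix (Fin 2) (Fin 2) ℂ, (∀ j, j ≤ n' → ∀ x ∈ cubeFam false (F.P K).L a M' ρ' (K - n) j, trCLM (Fin 2) (f x) = 0) → ∀ x, trCLM (Fin 2) (g f x) = 0) ∧
      (∀ f : LSite (F.P K).d → Matrix (Fin 2) (Fin 2) ℂ, (∀ j, j ≤ n' → ∀ x ∈ cubeFam false (F.P K).L a M' ρ' (K - n) j, trCLM (Fin 2) (f x) = 0) →
        ∀ j, j ≤ n' → ∀ x ∈ cubeFam false (F.P K).L a M' ρ' (K - n) j, trCLM (Fin 2) ((f - g (qs (c (q (g f))))) x) = 0))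
    {B₀β cB9 β : ℝ}
    (SB9all : ∀ m, m ≤ K - n → ∃ len : LSite (F.P K).d → ℝ,
      @SockB9P3 (F.P K).d (Matrix (Fin 2) (Fin 2) ℂ) (B10Eq29TubeLine.cstarAlgebraMatrix 2) (F.P K).L B₀ B₀β cB9 β len (((F.L : ℝ)⁻¹) ^ (K - n)) m
        (cubeFam false (F.P K).L a M' ρ' (K - n)) (cubeLamS (F.P K).L a M' ρ' (K - n)) (cubeLamB (F.P K).L a M' ρ' (K - n)))
    -- the b9 threshold's two windows for the (1.59) junction (§1)
    (hε9 : ε₀ ≤ cB9) (h9 : 2 * ((F.P K).L * cstar) + 8 * α₄ ≤ cB9)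
    -- THE JOIN's SCALAR WINDOWS at `(ε₀, α₁)` as ONE conjunction — letter for letter the conclusion of lit ✓`B8SockHFPWindows.hfpWindows_of_guard` at `d := 3`, `L := F.L` (served below
    -- ONE threshold `cP(L, B₀, B₀′, B₀′_H, B₂′, B_G, B_R, c_{b9})` on `ε₀ + α₁` under `3·(2dL²)·B_G·B_R ≤ B₀′`; §3)
    (hwin : ∀ cs α₄' cB cDA hE hE₂ lE lE₂ : ℝ, cs = 5 * ((F.P K).d : ℝ) * (F.P K).L * B₀ * (ε₀ + α₁) → α₄' = 8 * B₀' * (5 * ((F.P K).d : ℝ) * (F.P K).L * B₀) * (ε₀ + α₁) →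
      cB = (F.P K).L * cs → cDA = 2 * ((F.P K).d : ℝ) * ((F.P K).L : ℝ) ^ 2 * cs →
      hE = B₀'H * (C2p (F.P K).d * (40 * (F.P K).d * cB + α₄') * α₄') → hE₂ = B₂' * (C2p (F.P K).d * (40 * (F.P K).d * cB + α₄') * α₄') →
      lE = B₀'H * (4 * C2p (F.P K).d * (40 * (F.P K).d * cB + 2 * α₄')) → lE₂ = B₂' * (4 * C2p (F.P K).d * (40 * (F.P K).d * cB + 2 * α₄')) →
      36 * (F.P K).d * B₀ * cs ≤ 1 / 2 ∧
      8 * (131072 * (((F.P K).d : ℝ) + 1) ^ 2) * Real.exp (4 * (800 * (((F.P K).d : ℝ) + 1) ^ 2 * (((F.P K).d : ℝ) + 4)) * ε₀) ≤ 16 * (131072 * (((F.P K).d : ℝ) + 1) ^ 2) ∧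
      2 * cs ^ 2 + 20 * (F.P K).d * ε₀ * cs + 2 * (16 * (131072 * (((F.P K).d : ℝ) + 1) ^ 2)) * cs ^ 2 ≤ ε₀ + α₁ ∧
      ((F.P K).d : ℝ) * (F.P K).L * α₁ ≤ 1 / 8 ∧
      ε₀ ≤ cB9 ∧ cs ≤ cB9 ∧
      C0 (F.P K).d * ε₀ ≤ 1 / 3 ∧ 4 * ε₀ ≤ c2' (F.P K).d (F.P K).L ∧
      Real.exp (4 * (800 * (((F.P K).d : ℝ) + 1) ^ 2 * (((F.P K).d : ℝ) + 4)) * ε₀) * (1 + 8 * (131072 * (((F.P K).d : ℝ) + 1) ^ 2) * cB) ≤ 2 ∧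
      2 * cB ≤ c3 (F.P K).d (F.P K).L ∧ 2048 * ((F.P K).d : ℝ) * cB ≤ 1 ∧ 40 * (F.P K).d * cB ≤ 1 / 200 ∧
      200 * C6 (F.P K).d * (2 * α₄') ≤ 1 ∧ 12000 * (((F.P K).d : ℝ) + 1) * (F.P K).L * (2 * α₄') ≤ 1 ∧
      C4G (F.P K).d (F.P K).L * (ε₀ + 40 * (F.P K).d * cB + 4 * (2 * α₄')) ≤ 1 ∧
      1024 * (((F.P K).d : ℝ) + 1) * (((F.P K).d : ℝ) + 4) * (F.P K).L ^ 2 * ε₀ ≤ 1 ∧ 32 * (((F.P K).d : ℝ) + 1) ^ 2 * C6 (F.P K).d * (F.P K).L ^ 2 * ε₀ ≤ 1 ∧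
      16 * (F.P K).d * C5' (F.P K).d * C6 (F.P K).d * ((F.P K).L : ℝ) ^ 2 * ε₀ ≤ 1 ∧ 8 * (F.P K).d * C6 (F.P K).d * (F.P K).L * ε₀ ≤ 1 ∧
      40 * (F.P K).d * cB + α₄' ≤ 1 / (4 * B₀'H * (2 * C2p (F.P K).d)) ∧ 2 * C6 (F.P K).d * (40 * (F.P K).d * cB + 4 * α₄') ≤ 1 / 8 ∧
      cB ≤ 1 / 13 ∧ α₄' / 4 + hE ≤ 1 / 24 ∧ α₄' / 4 + hE ≤ 1 / 140 ∧ 10 * (α₄' / 4 + hE) * BR ≤ 1 / 2 ∧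
      BG * Mc (F.P K).d BR (α₄' / 4 + hE) cB hE₂ cDA ≤ α₄' / 4 ∧
      BG * Kc (F.P K).d BR (α₄' / 4 + hE) cB hE₂ cDA lE₂ (1 + lE) (1 + lE) ≤ 1 / 2)
 :
    ∀ gJ : GaugeTransf (F.P K) 0 (Matrix.specialUnitaryGroup (Fin 2) ℂ),
      InAk (F.P K).L (K - n) (((F.L : ℝ)⁻¹) ^ (K - n)) ε₀ (fun _ => (Set.univ : Set (LSite (F.P K).d))) (pull (unitsField (toUField (GaugeField.gaugeAct gJ U))) 0) →
      (∀ m', m' ≤ K - n → ∀ Λ : ℕ → Set (LSite (F.P K).d),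
        InAx (F.P K).L m' Λ (1 : LSite (F.P K).d → Fin (F.P K).d → (Matrix (Fin 2) (Fin 2) ℂ)ˣ) (pull (unitsField (toUField (GaugeField.gaugeAct gJ U))) 0)) →
      (∀ m', m' ≤ K - n → ∀ (x : LSite (F.P K).d) (ν : Fin (F.P K).d), tlo (F.P K).L (tLo a ρ') m' ≤ x → x + e ν ≤ thi (F.P K).L (tHi a M' ρ') m' →
        ‖((avgIter (F.P K).L (pull (unitsField (toUField (GaugeField.gaugeAct gJ U))) 0) (K - n - m') x ν : (Matrix (Fin 2) (Fin 2) ℂ)ˣ) :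
            Matrix (Fin 2) (Fin 2) ℂ) - 1‖ < s) →
      (∀ (x : LSite (F.P K).d) (ν : Fin (F.P K).d), tlo (F.P K).L (tLo a ρ') (K - n) ≤ x → x + e ν ≤ thi (F.P K).L (tHi a M' ρ') (K - n) →
        ‖((pull (unitsField (toUField (GaugeField.gaugeAct gJ U))) 0 x ν : (Matrix (Fin 2) (Fin 2) ℂ)ˣ) : Matrix (Fin 2) (Fin 2) ℂ) - 1‖ < s) →
      ∀ m, m ≤ K - n → ∃ u : LSite (F.P K).d → (Matrix (Fin 2) (Fin 2) ℂ)ˣ, (∀ x, ((u x : (Matrix (Fin 2) (Fin 2) ℂ)ˣ) : Matrix (Fin 2) (Fin 2) ℂ) ∈ Matrix.specialUnitaryGroup (Fin 2) ℂ) ∧ Restr129 (F.P K).L m ((cubeLamS (F.P K).L a M' ρ' (K - n)) m) (1 : LSite (F.P K).d → Fin (F.P K).d → (Matrix (Fin 2) (Fin 2) ℂ)ˣ) u ∧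
      ∃ W : LSite (F.P K).d → Fin (F.P K).d → (Matrix (Fin 2) (Fin 2) ℂ)ˣ, mgauge (1 : LSite (F.P K).d → Fin (F.P K).d → (Matrix (Fin 2) (Fin 2) ℂ)ˣ) u W = (pull (unitsField (toUField (GaugeField.gaugeAct gJ U))) 0) ∧ (1 ≤ m → IsLandau138W (F.P K).L m (((F.L : ℝ)⁻¹) ^ (K - n)) ((cubeFam false (F.P K).L a M' ρ' (K - n)) 0) ((cubeLamS (F.P K).L a M' ρ' (K - n)) m) (1 : LSite (F.P K).d → Fin (F.P K).d → (Matrix (Fin 2) (Fin 2) ℂ)ˣ) W) ∧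
        ∃ A : LSite (F.P K).d → Fin (F.P K).d → (Matrix (Fin 2) (Fin 2) ℂ), ∀ j, j ≤ m → ∀ b ∈ {b : LSite (F.P K).d × Fin (F.P K).d | SideTouches ((cubeFam false (F.P K).L a M' ρ' (K - n)) j) b.1 b.2},
          W b.1 b.2 = cfgExp (((F.L : ℝ)⁻¹) ^ (K - n)) A b.1 b.2 ∧ IsSelfAdjoint (A b.1 b.2) ∧ ‖A b.1 b.2‖ ≤ cstar * (((F.P K).L : ℝ) ^ j * (((F.L : ℝ)⁻¹) ^ (K - n)))⁻¹  := by
  have hα₄0 : 0 ≤ α₄ := by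
    rw [hα₄]
    have : 0 ≤ ε₀ + α₁ := by linarith
    positivity
  exact hT4T_of_leafSockets F L hF hnK ρ S M M' hρ'def hε₀ U x₀ hadef hα₁ hB₀ hB₀' hsα₁ hsmall₁ hc hα₄ hs₁ hs₂ hsa4 hs2c hα3 hα4 h16 hd5 hsmall hc₃ hside h50 hC₂ h61
    hB₀'H hB₂' hBG hBR SLetτAll SB9all hwin (H59raw_of_SB9all F L ρ S M M' hρ'def hε₀ U x₀ hadef hα₁ hB₀ hB₀' hc hα₄ SB9all hε9 h9)

/-! ## §3 The JOIN's windows `hwin` below ONE threshold on `ε₀ + α₁` (lit ✓`B8SockHFPWindows.hfpWindows_of_guard` at `d := 3`) -/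

/-- **THE WINDOW CONJUNCTION `hwin` OF §2 ∕ FILE B BELOW ONE THRESHOLD** — lit ✓`B8SockHFPWindows.hfpWindows_of_guard` at the member's lattice letters `(F.P K).d = 3`, `(F.P K).L = F.L`:
for `B₀, B₀′ > 0` with `2 ≤ 5dLB₀` (p. 89), letters constants `B₀′_H > 0`, `B₂′, B_G, B_R ≥ 0`, a b9 threshold `c_{b9} > 0` and the free-constant condition `3·(2dL²)·B_G·B_R ≤ B₀′`
((1.102)–(1.103) p.93) there is `cP > 0` — a function of `(L, B₀, B₀′, B₀′_H, B₂′, B_G, B_R, c_{b9})` only, hence member-uniform per `L` — such that `ε₀ + α₁ ≤ cP` gives `hwin`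
at `(ε₀, α₁)`.  (The door's `a₅` absorbs `cP`; alternatively the pack discharges `hwin`'s conjuncts from ✓p655819's harvest.) [cite: Balaban1985RegularSpaces, Thm 4 p.88 («there exists a constant c₁»), (1.102)–(1.103) p.93, (1.106) p.94, Prop. 3 p.87, p.89] -/
theorem exists_threshold_hwin (K : ℕ) {B₀ B₀' B₀'H B₂' BG BR cB9 : ℝ} (hB₀ : 0 < B₀) (hB₀' : 0 < B₀')
    (hB : 2 ≤ 5 * ((F.P K).d : ℝ) * (F.P K).L * B₀) (hB₀'H : 0 < B₀'H) (hB₂' : 0 ≤ B₂') (hBG : 0 ≤ BG) (hBR : 0 ≤ BR) (hcB9 : 0 < cB9)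
    (hfree : 3 * (2 * ((F.P K).d : ℝ) * ((F.P K).L : ℝ) ^ 2) * BG * BR ≤ B₀') :
    ∃ cP : ℝ, 0 < cP ∧ ∀ ε₀ α₁ : ℝ, 0 < ε₀ → 0 < α₁ → ε₀ + α₁ ≤ cP →
      ∀ cs α₄' cB cDA hE hE₂ lE lE₂ : ℝ, cs = 5 * ((F.P K).d : ℝ) * (F.P K).L * B₀ * (ε₀ + α₁) → α₄' = 8 * B₀' * (5 * ((F.P K).d : ℝ) * (F.P K).L * B₀) * (ε₀ + α₁) →
      cB = (F.P K).L * cs → cDA = 2 * ((F.P K).d : ℝ) * ((F.P K).L : ℝ) ^ 2 * cs →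
      hE = B₀'H * (C2p (F.P K).d * (40 * (F.P K).d * cB + α₄') * α₄') → hE₂ = B₂' * (C2p (F.P K).d * (40 * (F.P K).d * cB + α₄') * α₄') →
      lE = B₀'H * (4 * C2p (F.P K).d * (40 * (F.P K).d * cB + 2 * α₄')) → lE₂ = B₂' * (4 * C2p (F.P K).d * (40 * (F.P K).d * cB + 2 * α₄')) →
      36 * (F.P K).d * B₀ * cs ≤ 1 / 2 ∧
      8 * (131072 * (((F.P K).d : ℝ) + 1) ^ 2) * Real.exp (4 * (800 * (((F.P K).d : ℝ) + 1) ^ 2 * (((F.P K).d : ℝ) + 4)) * ε₀) ≤ 16 * (131072 * (((F.P K).d : ℝ) + 1) ^ 2) ∧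
      2 * cs ^ 2 + 20 * (F.P K).d * ε₀ * cs + 2 * (16 * (131072 * (((F.P K).d : ℝ) + 1) ^ 2)) * cs ^ 2 ≤ ε₀ + α₁ ∧
      ((F.P K).d : ℝ) * (F.P K).L * α₁ ≤ 1 / 8 ∧
      ε₀ ≤ cB9 ∧ cs ≤ cB9 ∧
      C0 (F.P K).d * ε₀ ≤ 1 / 3 ∧ 4 * ε₀ ≤ c2' (F.P K).d (F.P K).L ∧
      Real.exp (4 * (800 * (((F.P K).d : ℝ) + 1) ^ 2 * (((F.P K).d : ℝ) + 4)) * ε₀) * (1 + 8 * (131072 * (((F.P K).d : ℝ) + 1) ^ 2) * cB) ≤ 2 ∧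
      2 * cB ≤ c3 (F.P K).d (F.P K).L ∧ 2048 * ((F.P K).d : ℝ) * cB ≤ 1 ∧ 40 * (F.P K).d * cB ≤ 1 / 200 ∧
      200 * C6 (F.P K).d * (2 * α₄') ≤ 1 ∧ 12000 * (((F.P K).d : ℝ) + 1) * (F.P K).L * (2 * α₄') ≤ 1 ∧
      C4G (F.P K).d (F.P K).L * (ε₀ + 40 * (F.P K).d * cB + 4 * (2 * α₄')) ≤ 1 ∧
      1024 * (((F.P K).d : ℝ) + 1) * (((F.P K).d : ℝ) + 4) * (F.P K).L ^ 2 * ε₀ ≤ 1 ∧ 32 * (((F.P K).d : ℝ) + 1) ^ 2 * C6 (F.P K).d * (F.P K).L ^ 2 * ε₀ ≤ 1 ∧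
      16 * (F.P K).d * C5' (F.P K).d * C6 (F.P K).d * ((F.P K).L : ℝ) ^ 2 * ε₀ ≤ 1 ∧ 8 * (F.P K).d * C6 (F.P K).d * (F.P K).L * ε₀ ≤ 1 ∧
      40 * (F.P K).d * cB + α₄' ≤ 1 / (4 * B₀'H * (2 * C2p (F.P K).d)) ∧ 2 * C6 (F.P K).d * (40 * (F.P K).d * cB + 4 * α₄') ≤ 1 / 8 ∧
      cB ≤ 1 / 13 ∧ α₄' / 4 + hE ≤ 1 / 24 ∧ α₄' / 4 + hE ≤ 1 / 140 ∧ 10 * (α₄' / 4 + hE) * BR ≤ 1 / 2 ∧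
      BG * Mc (F.P K).d BR (α₄' / 4 + hE) cB hE₂ cDA ≤ α₄' / 4 ∧
      BG * Kc (F.P K).d BR (α₄' / 4 + hE) cB hE₂ cDA lE₂ (1 + lE) (1 + lE) ≤ 1 / 2 := by
  have hd1 : 1 ≤ (F.P K).d := by rw [T3Family.P_d F K]; norm_num
  have hL1 : 1 ≤ (F.P K).L := le_trans (by norm_num) (F.P K).hL.2
  exact hfpWindows_of_guard hd1 hL1 hB₀ hB₀' hB hB₀'H hB₂' hBG hBR hcB9 hfree

end Summit.QuantumFields.YangMills.Theorems.HalvingHSiteT4OfLeafSocketsB9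

end
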